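import Summits.QuantumFields.YangMills.Theorems.BalabanUVNodesN07SymNearRowsQA
import Summits.QuantumFields.YangMills.Theorems.BalabanUVNodesN07DbarHQnear
import Summits.QuantumFields.YangMills.Theorems.BalabanUVNodesN07MeetFamilyAtRecord
import HarnessLib

/-!
# N07 [B11] (= [15] = [Balaban1985Variational]) Sect. F — MODULE 99″ (E-edition; plan g93 A3⁵ ∕ director №311a (β), chart side (III)-5): **(c′) DISCHARGED IN BINDER FORM UNDER THE
# φ-b₂ PREMISE WITH A LEVEL-DEPENDENT DEFECT** — the (c′) letter `hQnear` of 89⁵∕90⁵ (at `NrmSymPhiOfRecord … (Ψ ε j)`) PROVED from the K0 assembler's numerics at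
# `β₁ ε δ j := L·(2·(X₀′·δ_j + Ω_j·(1 + X₀′·δ_j)) + 64·60800·ℓ²·(κ·ε_j·L)²)`, `Ω_j = ω_j + ω_j + ω_j²`, `ω_j = φ_j + 6Ψ ε j + 6φ_j·Ψ ε j`, `φ_j = 100·(240ℓ²κε_jL)²` — MODULE 99 re-cut:
# the adapter from the binder's prefix to MODULE 98′ (instantiated at the scalar `ψ := Ψ ε j`); `Adm22 D″ R (L·M_h)` is the NON-widened named instance
# `adm22_meetCube_trunc_seqOfRecord`; when `Ψ ε j ≤ ψc·(κε_j)²` every non-δ part of `β₁` is ε²-type (the `Q·ε_j²` slot; (Q-ψ₂) YES; n07-e ⚑ I.30825)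

Cell `pub-ymgap`, seat `pub-ymgap-dag-n07-e` g30 (FAN-OUT §N07 row s3; LANE OWNER of the K0 road chart side).  `--kind proof --supports stmt-QuantumFields-20541 --as helper` (K0⁷);
count-neutral; ONE theorem (0 `def`).  [15] = [Balaban1985Variational]; [3] = [Balaban1985Averaging]; [6] = [Balaban1985RegularSpaces]; [4] = [Balaban1984PropagatorsII]; [I] = [Balaban1987RG1].

WHAT IS PROVED (sorry-free; axioms standard).  ★★★ `hQnear_symPhiE_of_guards (F N)`: under the structural letters of 90⁵, any guard `Adm` with the two displayed consequences,
`2L ≤ R·(L·M_h) + 1`, `0 < B₃`, `0 ≤ κ`, the numeric guards on `a₀` (`243200·ℓ²·κ·L·a₀ ≤ 1`, `60·ℓ²·κLa₀ < δ_N`, `5760ℓ²κLa₀ < δ_F`, `2880ℓ²κLa₀ < δ_N`, `240ℓ²κLa₀ ≤ 10⁻⁴`), on `a₁`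
(MODULE 68's `δ_N`-guard, the sym within-block guard), and the per-level defect guards `0 ≤ Ψ ε j ≤ 1∕32`, `X₀′·a₁ + 2Ω_j ≤ ½` (for `0 ≤ ε_j ≤ a₀`) — the `hQnear` binder of 89⁵∕90⁵ HOLDS
at the displayed `β₁` (`ℓ = 6L`, `d = 4`).
HONEST SCOPE: by-name composition (MODULE 98′ + bookkeeping); the guards are the K0 assembler's numerics; `NrmSymPhiOfRecord` arrives through the binder (CONDITIONAL premise
`HThm4RecSym152PhiE`, N05's (B′) road — UNDISCHARGED); HSEAM and the budget row remain the token's displayed hypotheses ((d′)-Lam is ✓p741304); nothing of [15]∕[6]∕[3] ANALYSIS asserted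
beyond the cited lemmas; K0⁷ NOT closed; N07 NOT discharged; counts unmoved; one finite 𝕋⁴ programme at fixed ε — the route closes the conditional finite-𝕋⁴ rung `BalabanLadder.UV`
ONLY; the YM mass gap (Clay) is NOT proved by any of this; nothing continuum ∕ ℝ⁴ ∕ OS.  No `def`, no `instance`, no `notation`, no `sorry`.

References: [15] (144) p. 300, (147)–(157) pp. 301–302, (160) p. 303, (163) p. 304; [3] (26) p. 22, (78)–(81) p. 30, Prop. 4 (134)–(135) p. 38; [6] Lemma 1 (1.25) p. 79, p. 98,
(1.131) p. 99; [4] (2.1)–(2.3) p. 224; [I] (0.4), (0.6), (0.11) p. 253.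
-/

set_option autoImplicit false

noncomputable section

open scoped BigOperators Matrix.Norms.L2Operator

namespace Summit.QuantumFields.YangMills.BalabanUVNodes.N07SymHQnearPhiE

open Literature.MathematicalPhysics.QuantumFieldTheory.Balaban1983to89
open Literature.MathematicalPhysics.QuantumFieldTheory.Balaban1983to89.Node00
open Literature.MathematicalPhysics.QuantumFieldTheory.Balaban1983to89.B15DeterminingSets
open Literature.MathematicalPhysics.QuantumFieldTheory.Balaban1983to89.B12RegularSpaces111 (gaugeU expI grad)
open LatticeFieldCalculus (bondAvgIter)
open B15Eq112TorusCover (cover)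
open B14DomainGeom (Pt Within)
open B5Eq118OneStroke (iterBlockOf)
open B8Eq131Cubes (sqLo sqHi box cube tLo tHi crad)
open B6SectADomainsV1 (Domains)
open B6SectAOperatorsV1 (BondIdx RE dsE QpE)
open Literature.MathematicalPhysics.QuantumFieldTheory.BalabanImbrieJaffe1984to88.BIJ85AxialPropagator411 (BondSpace)
open T4Continuum (T4Family)
open GaugeField (gaugeAct)
open ExpMeanLog (deltaSU)
open FederbushMean (federbushSU deltaFed)
open Summit.QuantumFields.YangMills.Theorems.FlatCubeOpsText (Adm22)
open Summit.QuantumFields.YangMills.BalabanUVNodes.N07Thm4RecordStructureSym152Phi (NrmSymPhiOfRecord)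
open Summit.QuantumFields.YangMills.BalabanUVNodes.N07MeetFamilyAtRecord (adm22_meetCube_trunc_seqOfRecord)
open Summit.QuantumFields.YangMills.BalabanUVNodes.N07SymNearRowsQAPhi (norm_bondAvgIter_le_of_near_symPhi)
open Summit.QuantumFields.YangMills.BalabanUVNodes.N07DatumGauge152Guarded (numerics_cornerP_of_levelGuard two_mul_pow_le_sitesPerDir_of_levelGuard)

/-! ## §2  (c′) in binder form -/

section Record

variable (F : T4Family) (N : ℕ) [NeZero N]

set_option maxHeartbeats 800000 in
/-- ★★★ **(c′) IN BINDER FORM, LEVEL-DEPENDENT DEFECT** (statement in the header): the `hQnear` letter of 89⁵∕90⁵ at the displayed `β₁`, from the structural letters, the guard `Adm`'s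
two consequences, the numeric guards on `a₀`, `a₁` and the per-level defect guards.
[cite: Balaban1985Variational, (152)–(157) pp.301–302, (160) p.303, (163) p.304, (144) p.300, (147)–(150) p.301; Balaban1985Averaging, (26) p.22, (78)–(81) p.30, Prop. 4 (134)–(135) p.38; Balaban1985RegularSpaces, Lemma 1 (1.25) p.79, p.98, (1.131) p.99; Balaban1984PropagatorsII, (2.1)–(2.3) p.224; Balaban1987RG1, (0.6), (0.11) p.253] -/
theorem hQnear_symPhiE_of_guards
    {ρ Mc Mh R a' c c₀ : ℕ} (hMc : 1 ≤ Mc) (hMha : Mh = F.L ^ a') (hdvd : F.L * Mh ∣ ρ) (hRρ : R * (F.L * Mh) ≤ ρ) (hLρ : F.L ≤ ρ)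
    (hcfl : (11 * 4 + 4 * ρ + Mc + 3) * F.L ≤ c) (hc₀ : Mc + 11 * 4 + 6 * ρ + 1 ≤ 2 * F.L ^ c₀) (hac₀ : a' + 3 ≤ c₀)
    (Adm : StepGuard F) (hAdm₁ : ∀ (ν : Stage7Numerics) (M : ℕ) (g : ℕ → ℝ) (K k : ℕ) (s : SeqOfRecord F ν M g K k), Adm ν M g K k s → c ≤ ν.M₁ ∧ k + c₀ ≤ F.m + K)
    (hAdm₂ : ∀ (ν : Stage7Numerics) (M : ℕ) (g : ℕ → ℝ) (K k : ℕ) (s : SeqOfRecord F ν M g K k), Adm ν M g K k s → ∀ j : ℕ, 1 ≤ j → j ≤ k →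
      F.L * Mh ∣ M * RkOfRecord (F.P K).L ν.r (g j) ∧ dCubeSide (F.P K).L M (RkOfRecord (F.P K).L ν.r (g j)) j ∣ (F.P K).sitesPerDir 0)
    (hRM : 2 * F.L ≤ R * (F.L * Mh) + 1)
    {B₃ κ a₀ a₁ : ℝ} {Ψ : (ℕ → ℝ) → ℕ → ℝ} (hB₃ : 0 < B₃) (hκ : 0 ≤ κ)
    -- the numeric guards (the K0 assembler's choice of `a₀`, `a₁` after `ρ`, `Mc`, `κ`; `ψ = ψ₂`)
    (ha₀bud : 243200 * (((4 + 2) * F.L : ℕ) : ℝ) ^ 2 * (κ * a₀ * (F.L : ℝ)) ≤ 1)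
    (ha₀gd : 60 * (((4 + 2) * F.L : ℕ) : ℝ) ^ 2 * (κ * a₀ * (F.L : ℝ)) < deltaSU (Fin N))
    (ha₀σF : 5760 * (((4 + 2) * F.L : ℕ) : ℝ) ^ 2 * (κ * a₀ * (F.L : ℝ)) < deltaFed (Fin N))
    (ha₀σS : 2880 * (((4 + 2) * F.L : ℕ) : ℝ) ^ 2 * (κ * a₀ * (F.L : ℝ)) < deltaSU (Fin N))
    (ha₀σ4 : 240 * (((4 + 2) * F.L : ℕ) : ℝ) ^ 2 * (κ * a₀ * (F.L : ℝ)) ≤ 1 / 10000)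
    (hguard : ((((4 + 2) * F.L : ℕ) : ℝ) ^ 2 / 4) * ((4 * (((4 - 1 : ℕ) : ℝ) * ((2 * F.L - 1 : ℕ) : ℝ)) + 1) * a₁) < deltaSU (Fin N))
    (hguardF : 2 * (((4 * ((F.L - 1) / 2) : ℕ) : ℝ) * ((((4 - 1 : ℕ) : ℝ) * ((F.L - 1 : ℕ) : ℝ)) * a₁)) < (federbushSU (n := Fin N)).δ)
    -- ★ THE DEFECT's GUARDS, per level: sign, size (`≤ 1∕32`) and the range `X₀′·a₁ + 2Ω_j ≤ ½` (K0 numerics; `Ψ ε j = ψ₂` is ε²-type)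
    (hΨ : ∀ (ε : ℕ → ℝ) (j : ℕ), 0 ≤ ε j → ε j ≤ a₀ → 0 ≤ Ψ ε j ∧ Ψ ε j ≤ 1 / 32 ∧
      (((4 - 1 : ℕ) : ℝ) * ((crad (ρ * ((Mc + 11 * 4) / ρ + 2)) ρ : ℕ) : ℝ) * (1 + 2 * (((F.L : ℝ) ^ 2 + 6 * (((4 + 2) * F.L : ℕ) : ℝ) ^ 2) * (4 * (((4 - 1 : ℕ) : ℝ) * ((2 * F.L - 1 : ℕ) : ℝ)) + 1))) + 14 * ((((4 + 2) * F.L : ℕ) : ℝ) ^ 2 / 4 * (4 * (((4 - 1 : ℕ) : ℝ) * ((2 * F.L - 1 : ℕ) : ℝ)) + 1)) + 2 * (((4 + 1) * (F.L - 1) : ℕ) : ℝ) * ((((14 * (4 * ((F.L - 1) / 2)) + 1 : ℕ) : ℝ)) * (((4 - 1 : ℕ) : ℝ) * ((F.L - 1 : ℕ) : ℝ)))) * a₁ +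
        2 * ((100 * (240 * (((4 + 2) * F.L : ℕ) : ℝ) ^ 2 * (κ * ε j * (F.L : ℝ))) ^ 2 + 6 * Ψ ε j + 100 * (240 * (((4 + 2) * F.L : ℕ) : ℝ) ^ 2 * (κ * ε j * (F.L : ℝ))) ^ 2 * (6 * Ψ ε j)) + (100 * (240 * (((4 + 2) * F.L : ℕ) : ℝ) ^ 2 * (κ * ε j * (F.L : ℝ))) ^ 2 + 6 * Ψ ε j + 100 * (240 * (((4 + 2) * F.L : ℕ) : ℝ) ^ 2 * (κ * ε j * (F.L : ℝ))) ^ 2 * (6 * Ψ ε j)) + (100 * (240 * (((4 + 2) * F.L : ℕ) : ℝ) ^ 2 * (κ * ε j * (F.L : ℝ))) ^ 2 + 6 * Ψ ε j + 100 * (240 * (((4 + 2) * F.L : ℕ) : ℝ) ^ 2 * (κ * ε j * (F.L : ℝ))) ^ 2 * (6 * Ψ ε j)) * (100 * (240 * (((4 + 2) * F.L : ℕ) : ℝ) ^ 2 * (κ * ε j * (F.L : ℝ))) ^ 2 + 6 * Ψ ε j + 100 * (240 * (((4 + 2) * F.L : ℕ) : ℝ) ^ 2 * (κ * ε j * (F.L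 : ℝ))) ^ 2 * (6 * Ψ ε j))) ≤ 1 / 2) :
        ∀ (ν : Stage7Numerics) (M : ℕ) (g : ℕ → ℝ) (K k : ℕ) (s : SeqOfRecord F ν M g K k), Sect2.SeqSeparated ν.M₁ s → 0 < ν.M₁ →
      Adm ν M g K k s → 1 ≤ k →
      ∀ (ε δ : ℕ → ℝ),
      (∀ n, n ≤ k → 0 < δ n ∧ δ n ≤ a₁) → (∀ n, n < k → δ n ≤ 2 * δ (n + 1)) → (∀ n, n < k → δ (n + 1) ≤ 2 * δ n) →
      (∀ n, n ≤ k → B₃ * δ n ≤ ε n ∧ ε n ≤ a₀) → (∀ n, n < k → ε n ≤ 2 * ε (n + 1)) → (∀ n, n < k → ε (n + 1) ≤ 2 * ε n) →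
      ∀ W : MSField (F.P K) (SU N), Sect2.DataSmall7PTop (avOfRecord F N K) s.Ω (suppDomOfRecord F ν K s.Ω) k δ W →
      ∀ U : GaugeField (F.P K) 0 (SU N),
      (∀ n, n ≤ k → PlaqSmallOn (Sect2.omegaPlaqsTop s.Ω (suppDomOfRecord F ν K s.Ω) n) (ε n * (F.P K).eta n ^ 2) U) →
      (∀ n, n ≤ k → Sect2.CoDivSmallOn (Sect2.omegaBondsTop s.Ω (suppDomOfRecord F ν K s.Ω) n) (ε n * (F.P K).eta n ^ 3) U) →
      AgreeOn (genSet s.Ω k) (avgFamily (avOfRecord F N K) U) W → IsCritOnFibre F N K (genSet s.Ω k) W U →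
      ∀ (n : ℕ) (hk : K - n ≤ (F.P K).m + (F.P K).K), 1 ≤ K - n → K - n ≤ k → ∀ (idx : Pt (F.P K).d),
      -- MEETING DATUMS ONLY: the print box has a point within `3` of a lift of a site of `Ω_{K−n}`
      (∃ x ∈ box (F.P K).L (cornerP (F.P K) Mc ρ idx) (sideP (F.P K) Mc ρ) (K - n), ∃ y : Pt (F.P K).d, cover (F.P K) y ∈ s.Ω (K - n) ∧ Within ((3 : ℕ) : ℤ) x y) →
      -- PRINT-MARGIN-CLEAN DATUMS ONLY (print p. 300 + (144)'s margin cube «□̃» = the print box WIDENED BY `2ρ` BLOCKS): top level, or «□̃» misses `Ω_{j+1}`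
      (K - n = k ∨ ∀ z ∈ box (F.P K).L (cornerP (F.P K) Mc ρ idx - ((2 * ρ : ℕ) : Pt (F.P K).d)) (sideP (F.P K) Mc ρ + 2 * (2 * ρ)) (K - n),
        cover (F.P K) z ∉ s.Ω (K - n + 1)) →
      -- THE FAMILY: print's (150) `Ω′_j = □_j (j < k), Ω′_k = □_k ∩ Ω_k`
      ∀ {HVd : Domains (F.P K)}
        (_ : HVd = domainsMeet (cubeDomains (F.P K) (cornerP (F.P K) Mc ρ idx) (sideP (F.P K) Mc ρ) ρ (K - n) hk) (domainsOfSeq s.Ω (K - n) hk))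
        (lo hi : ℕ → Pt (F.P K).d),
      lo 0 = (fun i => ((F.P K).L : ℤ) * (sqLo (F.P K).L (cornerP (F.P K) Mc ρ idx) ρ (K - n) 1 i - 1)) →
      hi 0 = (fun i => ((F.P K).L : ℤ) * (sqHi (F.P K).L (cornerP (F.P K) Mc ρ idx) (sideP (F.P K) Mc ρ) ρ (K - n) 1 i + 1) + (((F.P K).L : ℤ) - 1)) →
      (∀ j', 1 ≤ j' → lo j' = sqLo (F.P K).L (cornerP (F.P K) Mc ρ idx) ρ (K - n) j' - 1) →
      (∀ j', 1 ≤ j' → hi j' = sqHi (F.P K).L (cornerP (F.P K) Mc ρ idx) (sideP (F.P K) Mc ρ) ρ (K - n) j' + 1) →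
      ∀ (u : GaugeTransf (F.P K) 0 (SU N)) (A : PBond (F.P K) 0 → MatA N),
      (∀ b ∈ (Sect2.regionOfSet (F.P K) (cover (F.P K) '' box (F.P K).L (cornerP (F.P K) Mc ρ idx) (sideP (F.P K) Mc ρ) (K - n))).bonds,
        gaugeU (fun x => ιSU N (u x)) (fun b' => ιSU N (U b')) b = expI ((F.P K).eta (K - n)) (A b)) →
      -- (T1) the gauge equation on the WHOLE TOWER `□₀` of the datum
      (∀ b ∈ (Sect2.regionOfSet (F.P K) (cover (F.P K) '' cube (F.P K).L (cornerP (F.P K) Mc ρ idx) (sideP (F.P K) Mc ρ) ρ (K - n) 0)).bonds,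
        gaugeU (fun x => ιSU N (u x)) (fun b' => ιSU N (U b')) b = expI ((F.P K).eta (K - n)) (A b)) →
      -- (T2) (152)'s LEVEL-WEIGHTED letters on every `□_{j′}`, `j′ ≤ K − n`
      (∀ j', j' ≤ K - n →
        ∀ b ∈ (Sect2.regionOfSet (F.P K) (cover (F.P K) '' cube (F.P K).L (cornerP (F.P K) Mc ρ idx) (sideP (F.P K) Mc ρ) ρ (K - n) j')).bonds,
          ‖A b‖ < κ * ε (K - n) * ((F.P K).L : ℝ) ^ (K - n - j')) →
      (∀ b ∈ (Sect2.regionOfSet (F.P K) (cover (F.P K) '' box (F.P K).L (cornerP (F.P K) Mc ρ idx) (sideP (F.P K) Mc ρ) (K - n))).bonds,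
        ‖A b‖ < κ * ε (K - n)) →
      (∀ q ∈ (Sect2.regionOfSet (F.P K) (cover (F.P K) '' box (F.P K).L (cornerP (F.P K) Mc ρ idx) (sideP (F.P K) Mc ρ) (K - n))).dpairs,
        ‖grad ((F.P K).eta (K - n)) q.2.1 (fun y => A ⟨y, q.2.2⟩) q.1‖ < κ * ε (K - n)) →
      (∀ b ∈ Sect2.bondsDeep (cover (F.P K) '' box (F.P K).L (cornerP (F.P K) Mc ρ idx) (sideP (F.P K) Mc ρ) (K - n)),
        ‖Sect2.codiffCurlA ((F.P K).eta (K - n)) A b.src b.dir‖ < κ * ε (K - n)) →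
      (∀ b ∈ Sect2.bondsDeep (cover (F.P K) '' box (F.P K).L (cornerP (F.P K) Mc ρ idx) (sideP (F.P K) Mc ρ) (K - n)),
        ‖∑ ν' : Fin (F.P K).d, (((F.P K).eta (K - n) : ℝ) : ℂ)⁻¹ •
            (grad ((F.P K).eta (K - n)) ν' (fun y => A ⟨y, b.dir⟩) (b.src.unshift ν') - grad ((F.P K).eta (K - n)) ν' (fun y => A ⟨y, b.dir⟩) b.src)‖ <
          κ * ε (K - n)) →
      (∀ D' : Domains (F.P K), LinearMap.ker (QpE D') ≤ LinearMap.ker (QpE HVd) → ∀ φ : MatA N →L[ℂ] ℂ,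
        RE D' ((F.P K).eta (K - n))⁻¹ (dsE ((F.P K).eta (K - n))⁻¹ (WithLp.toLp 2 fun b => (φ (A b)).re : BondSpace (F.P K))) = 0 ∧
        RE D' ((F.P K).eta (K - n))⁻¹ (dsE ((F.P K).eta (K - n))⁻¹ (WithLp.toLp 2 fun b => (φ (A b)).im : BondSpace (F.P K))) = 0) →
      -- ★ THE NORMALISATION of this `u` (print's «ū_j = 1 on Λ′_j»), as delivered by HS3NORM
      NrmSymPhiOfRecord F N Mc ρ (Ψ ε (K - n)) ν M g K k s U (K - n) idx u A →
      ∀ c : BondIdx HVd, ((c.1.1 : ℕ) = K - n ∨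
          (blockOf c.1.2.src ∈ (cubeDomains (F.P K) (cornerP (F.P K) Mc ρ idx) (sideP (F.P K) Mc ρ) ρ (K - n) hk).Om ((c.1.1 : ℕ) + 1) ∧
            blockOf c.1.2.tgt ∈ (cubeDomains (F.P K) (cornerP (F.P K) Mc ρ idx) (sideP (F.P K) Mc ρ) ρ (K - n) hk).Om ((c.1.1 : ℕ) + 1))) →
        ‖bondAvgIter (c.1.1 : ℕ) A c.1.2‖ ≤ (fun (ε δ : ℕ → ℝ) (j : ℕ) => (F.L : ℝ) * (2 * ((((4 - 1 : ℕ) : ℝ) * ((crad (ρ * ((Mc + 11 * 4) / ρ + 2)) ρ : ℕ) : ℝ) * (1 + 2 * (((F.L : ℝ) ^ 2 + 6 * (((4 + 2) * F.L : ℕ) : ℝ) ^ 2) * (4 * (((4 - 1 : ℕ) : ℝ) * ((2 * F.L - 1 : ℕ) : ℝ)) + 1))) + 14 * ((((4 + 2) * F.L : ℕ) : ℝ) ^ 2 / 4 * (4 * (((4 - 1 : ℕ) : ℝ) * ((2 * F.L - 1 : ℕ) : ℝ)) + 1)) + 2 * (((4 + 1) * (F.L - 1) : ℕ) : ℝ)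 * ((((14 * (4 * ((F.L - 1) / 2)) + 1 : ℕ) : ℝ)) * (((4 - 1 : ℕ) : ℝ) * ((F.L - 1 : ℕ) : ℝ)))) * δ j + ((100 * (240 * (((4 + 2) * F.L : ℕ) : ℝ) ^ 2 * (κ * ε j * (F.L : ℝ))) ^ 2 + 6 * Ψ ε j + 100 * (240 * (((4 + 2) * F.L : ℕ) : ℝ) ^ 2 * (κ * ε j * (F.L : ℝ))) ^ 2 * (6 * Ψ ε j)) + (100 * (240 * (((4 + 2) * F.L : ℕ) : ℝ) ^ 2 * (κ * ε j * (F.L : ℝ))) ^ 2 + 6 * Ψ ε j + 100 * (240 * (((4 + 2) * F.L : ℕ) : ℝ) ^ 2 * (κ * ε j * (F.L : ℝ))) ^ 2 * (6 * Ψ ε j)) + (100 * (240 * (((4 + 2) * F.L : ℕ) : ℝ) ^ 2 * (κ * ε j * (F.L : ℝ))) ^ 2 + 6 * Ψ ε j + 100 * (240 * (((4 + 2) * F.L : ℕ) : ℝ) ^ 2 * (κ * ε j * (F.L : ℝ))) ^ 2 * (6 * Ψ ε j)) * (100 * (240 * (((4 + 2) * F.L : ℕ) : ℝ) ^ 2 *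 (κ * ε j * (F.L : ℝ))) ^ 2 + 6 * Ψ ε j + 100 * (240 * (((4 + 2) * F.L : ℕ) : ℝ) ^ 2 * (κ * ε j * (F.L : ℝ))) ^ 2 * (6 * Ψ ε j))) * (1 + (((4 - 1 : ℕ) : ℝ) * ((crad (ρ * ((Mc + 11 * 4) / ρ + 2)) ρ : ℕ) : ℝ) * (1 + 2 * (((F.L : ℝ) ^ 2 + 6 * (((4 + 2) * F.L : ℕ) : ℝ) ^ 2) * (4 * (((4 - 1 : ℕ) : ℝ) * ((2 * F.L - 1 : ℕ) : ℝ)) + 1))) + 14 * ((((4 + 2) * F.L : ℕ) : ℝ) ^ 2 / 4 * (4 * (((4 - 1 : ℕ) : ℝ) * ((2 * F.L - 1 : ℕ) : ℝ)) + 1)) + 2 * (((4 + 1) * (F.L - 1) : ℕ) : ℝ) * ((((14 * (4 * ((F.L - 1) / 2)) + 1 : ℕ) : ℝ)) * (((4 - 1 : ℕ) : ℝ) * ((F.L - 1 : ℕ) : ℝ)))) * δ j)) + 64 * 60800 * (((4 + 2) * F.L : ℕ) : ℝ) ^ 2 * (κ * ε j * (F.L : ℝ)) ^ 2)) ε δ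 (K - n) := by
  intro ν M g K k s hsep hM₁ hadm hk1 ε δ hδ hcompδ hcompδ' hε hεc hεc' W h7 U h17 h19 hfib hcrit n hk hk1' hjk idx hmeet hclean HVd hHVd lo hi hlo0 hhi0 hloj hhij
    u A hbox hT1 hT2 hAbox hgrad hcodiff hcurl hLandau hN cI hnear
  subst hHVd
  -- the guard's consequences
  obtain ⟨hcM, hlev⟩ := hAdm₁ ν M g K k s hadm
  have hgrid2 := hAdm₂ ν M g K k s hadm
  have hPd : (F.P K).d = 4 := rfl
  have hPL : (F.P K).L = F.L := rfl
  have hPm : (F.P K).m = F.m := rfl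
  have hPK : (F.P K).K = K := rfl
  have hL1 : 1 ≤ F.L := by have := F.hL11; omega
  have hkK : k ≤ (F.P K).m + (F.P K).K := by rw [hPm, hPK]; omega
  have hgrid : ∀ j : ℕ, 1 ≤ j → j ≤ k → dCubeSide (F.P K).L M (RkOfRecord (F.P K).L ν.r (g j)) j ∣ (F.P K).sitesPerDir 0 := fun j h1 hj => (hgrid2 j h1 hj).2
  have hρ1 : 1 ≤ ρ := le_trans hL1 hLρ
  have hLρ' : (F.P K).L ≤ ρ := by rw [hPL]; exact hLρ
  have hfloor : (11 * (F.P K).d + 4 * ρ + Mc) * (F.P K).L + 3 ≤ ν.M₁ := by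
    rw [hPd, hPL]
    have e : (11 * 4 + 4 * ρ + Mc + 3) * F.L = (11 * 4 + 4 * ρ + Mc) * F.L + 3 * F.L := by ring
    have h3 : 3 ≤ 3 * F.L := by omega
    omega
  have hjK : K - n + 1 ≤ (F.P K).m + (F.P K).K := by rw [hPm, hPK]; omega
  -- the window's non-wrapping from the level guard
  have hside : sideP (F.P K) Mc ρ ≤ Mc + 11 * 4 + 2 * ρ := by
    unfold sideP; rw [hPd, Nat.mul_add]
    have := Nat.mul_div_le (Mc + 11 * 4) ρ
    omega
  have h2pow : 2 * (F.P K).L ^ c₀ ≤ (F.P K).sitesPerDir (K - n) := two_mul_pow_le_sitesPerDir_of_levelGuard (P := F.P K) hjk (by rw [hPm, hPK]; exact hlev)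
  have hn : ∀ κ', (tHi (cornerP (F.P K) Mc ρ idx) (sideP (F.P K) Mc ρ) ρ) κ' ≤ (tLo (cornerP (F.P K) Mc ρ idx) ρ) κ' + (sideP (F.P K) Mc ρ + 4 * ρ - 1 : ℕ) := by
    intro κ'
    have hS1 : 1 ≤ sideP (F.P K) Mc ρ := by have := le_sideP (P := F.P K) Mc hρ1; omega
    simp only [tHi, tLo]
    omega
  have hnN : (sideP (F.P K) Mc ρ + 4 * ρ - 1 : ℕ) + 1 < (F.P K).sitesPerDir (K - n) := by
    rw [hPL] at h2pow; omega
  -- `Adm22 D″ R (L·M_h)` (the NON-widened named instance with the datum's grid numerics)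
  have hnum := numerics_cornerP_of_levelGuard F (Mc := Mc) hk1' hjk hlev hMha (by omega) hLρ' hdvd (by omega) idx
  obtain ⟨ha, hM, hper, -⟩ := hnum
  have hLMh : 1 ≤ F.L * Mh := by
    rw [hMha]; exact Nat.one_le_iff_ne_zero.mpr (Nat.mul_ne_zero (by omega) (pow_ne_zero _ (by omega)))
  have hν1 : 1 ≤ ν.M₁ := hM₁
  have hRsep : R * (F.L * Mh) + 1 ≤ (F.P K).L * ν.M₁ := by
    rw [hPL]
    have h1 : ν.M₁ ≤ F.L * ν.M₁ := Nat.le_mul_of_pos_left _ hL1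
    have h2 : ρ + 1 ≤ c := by
      have : 11 * 4 + 4 * ρ + Mc + 3 ≤ (11 * 4 + 4 * ρ + Mc + 3) * F.L := Nat.le_mul_of_pos_right _ hL1
      omega
    omega
  have hgran : ∀ j' : ℕ, 1 ≤ j' → j' ≤ K - n → F.L * Mh ∣ M * RkOfRecord (F.P K).L ν.r (g j') := fun j' h1 hj' => (hgrid2 j' h1 (hj'.trans hjk)).1
  have hdiv : ∀ j' : ℕ, 1 ≤ j' → j' ≤ K - n → dCubeSide (F.P K).L M (RkOfRecord (F.P K).L ν.r (g j')) j' ∣ (F.P K).sitesPerDir 0 :=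
    fun j' h1 hj' => hgrid j' h1 (hj'.trans hjk)
  have hAdmD := adm22_meetCube_trunc_seqOfRecord F ν M g K k s hjk hk hLMh hν1 hRsep hsep hdiv hgran hdvd ha hM hper hRρ
  have hRM' : 2 * (F.P K).L ≤ R * (F.L * Mh) + 1 := by rw [hPL]; exact hRM
  -- the letters at the datum's level
  have hδj : 0 < δ (K - n) := (hδ (K - n) hjk).1
  have hεj0 : 0 ≤ ε (K - n) := le_trans (by positivity : 0 ≤ B₃ * δ (K - n)) (hε (K - n) hjk).1
  have hεa : ε (K - n) ≤ a₀ := (hε (K - n) hjk).2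
  have hℓ0 : (0 : ℝ) ≤ (((4 + 2) * F.L : ℕ) : ℝ) := Nat.cast_nonneg _
  have hsm : κ * ε (K - n) * (F.L : ℝ) ≤ κ * a₀ * (F.L : ℝ) :=
    mul_le_mul_of_nonneg_right (mul_le_mul_of_nonneg_left hεa hκ) (Nat.cast_nonneg _)
  have hsm0 : 0 ≤ κ * ε (K - n) * (F.L : ℝ) := by positivity
  have hbud : 243200 * ((((F.P K).d + 2) * (F.P K).L : ℕ) : ℝ) ^ 2 * (κ * ε (K - n) * ((F.P K).L : ℝ)) ≤ 1 := by
    rw [hPd, hPL]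
    exact (mul_le_mul_of_nonneg_left hsm (by positivity)).trans ha₀bud
  have hgd : 60 * ((((F.P K).d + 2) * (F.P K).L : ℕ) : ℝ) ^ 2 * (κ * ε (K - n) * ((F.P K).L : ℝ)) < deltaSU (Fin N) := by
    rw [hPd, hPL]
    exact lt_of_le_of_lt (mul_le_mul_of_nonneg_left hsm (by positivity)) ha₀gd
  have hσF : 5760 * ((((F.P K).d + 2) * (F.P K).L : ℕ) : ℝ) ^ 2 * (κ * ε (K - n) * ((F.P K).L : ℝ)) < deltaFed (Fin N) := by
    rw [hPd, hPL]
    exact lt_of_le_of_lt (mul_le_mul_of_nonneg_left hsm (by positivity)) ha₀σF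
  have hσS : 2880 * ((((F.P K).d + 2) * (F.P K).L : ℕ) : ℝ) ^ 2 * (κ * ε (K - n) * ((F.P K).L : ℝ)) < deltaSU (Fin N) := by
    rw [hPd, hPL]
    exact lt_of_le_of_lt (mul_le_mul_of_nonneg_left hsm (by positivity)) ha₀σS
  have hσ4 : 240 * ((((F.P K).d + 2) * (F.P K).L : ℕ) : ℝ) ^ 2 * (κ * ε (K - n) * ((F.P K).L : ℝ)) ≤ 1 / 10000 := by
    rw [hPd, hPL]
    exact (mul_le_mul_of_nonneg_left hsm (by positivity)).trans ha₀σ4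
  -- the defect's guards at the datum's level
  obtain ⟨hψ0, hψ, hXj⟩ := hΨ ε (K - n) hεj0 hεa
  have hX' : ((((F.P K).d - 1 : ℕ) : ℝ) * ((crad (sideP (F.P K) Mc ρ) ρ : ℕ) : ℝ) * (1 + 2 * ((((F.P K).L : ℝ) ^ 2 + 6 * ((((F.P K).d + 2) * (F.P K).L : ℕ) : ℝ) ^ 2) * (4 * ((((F.P K).d - 1 : ℕ) : ℝ) * ((2 * (F.P K).L - 1 : ℕ) : ℝ)) + 1))) + 14 * (((((F.P K).d + 2) * (F.P K).L : ℕ) : ℝ) ^ 2 / 4 * (4 * ((((F.P K).d - 1 : ℕ) : ℝ) * ((2 * (F.P K).L - 1 : ℕ) : ℝ)) + 1)) + 2 * ((((F.P K).d + 1) * ((F.P K).L - 1) : ℕ) : ℝ) * ((((14 * ((F.P K).d * (((F.P K).L - 1) / 2)) + 1 : ℕ) : ℝ)) * ((((F.P K).d - 1 : ℕ) : ℝ) * (((F.P K).L - 1 : ℕ) : ℝ)))) * a₁ +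
      2 * ((100 * (240 * ((((F.P K).d + 2) * (F.P K).L : ℕ) : ℝ) ^ 2 * (κ * ε (K - n) * ((F.P K).L : ℝ))) ^ 2 + 6 * Ψ ε (K - n) + 100 * (240 * ((((F.P K).d + 2) * (F.P K).L : ℕ) : ℝ) ^ 2 * (κ * ε (K - n) * ((F.P K).L : ℝ))) ^ 2 * (6 * Ψ ε (K - n))) + (100 * (240 * ((((F.P K).d + 2) * (F.P K).L : ℕ) : ℝ) ^ 2 * (κ * ε (K - n) * ((F.P K).L : ℝ))) ^ 2 + 6 * Ψ ε (K - n) + 100 * (240 * ((((F.P K).d + 2) * (F.P K).L : ℕ) : ℝ) ^ 2 * (κ * ε (K - n) * ((F.P K).L : ℝ))) ^ 2 * (6 * Ψ ε (K - n))) + (100 * (240 * ((((F.P K).d + 2) * (F.P K).L : ℕ) : ℝ) ^ 2 * (κ * ε (K - n) * ((F.P K).L : ℝ))) ^ 2 + 6 * Ψ ε (K - n) + 100 * (240 * ((((F.P K).d + 2) * (F.P K).L : ℕ) : ℝ) ^ 2 * (κ * ε (K - n) * ((F.P K).L : ℝ))) ^ 2 * (6 * Ψ ε (K - n))) * (100 *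 (240 * ((((F.P K).d + 2) * (F.P K).L : ℕ) : ℝ) ^ 2 * (κ * ε (K - n) * ((F.P K).L : ℝ))) ^ 2 + 6 * Ψ ε (K - n) + 100 * (240 * ((((F.P K).d + 2) * (F.P K).L : ℕ) : ℝ) ^ 2 * (κ * ε (K - n) * ((F.P K).L : ℝ))) ^ 2 * (6 * Ψ ε (K - n)))) ≤ 1 / 2 := by
    rw [hPd, hPL]; unfold sideP; rw [hPd]
    exact hXj
  -- MODULE 98′ at the datum
  have h98 := norm_bondAvgIter_le_of_near_symPhi F N s hsep hkK hgrid hMc hρ1 hLρ' hfloor hδ hcompδ (by rw [hPd, hPL]; exact hguard) (by rw [hPd, hPL]; exact hguardF)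
    W h7 U hfib hk1' hjk hjK idx hmeet hclean hn hnN u A hκ hεj0 hT1 hT2 hbud hgd hσF hσS hσ4 hk hψ0 hψ hN hAdmD hRM' hX' cI hnear
  refine h98.trans (le_of_eq ?_)
  simp only [hPd, hPL, sideP]

end Record

end Summit.QuantumFields.YangMills.BalabanUVNodes.N07SymHQnearPhiE

end
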